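import Literature.MathematicalPhysics.QuantumFieldTheory.Balaban1983to89.B7Eq92Concrete
import Literature.MathematicalPhysics.QuantumFieldTheory.Balaban1983to89.B14Eq372ContourBCH
import Literature.MathematicalPhysics.QuantumFieldTheory.Balaban1983to89.MatrixNorms
import HarnessLib

/-!
# Support | NE7 (gen 96, ROAD-G96 §9∕§11, second brick of (Γ3)): THE ACCUMULATED FRAME (97) TO SECOND ORDER —
# `v_k(z) = Π_{m<k} w_m(L^{k−m}z)` is an ordered product of the one-block frames `w_m = exp Fcov_m`, so by [Balaban1988Convergent] (3.72)'s kernel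
# `‖log v_k(z) − Σ_{m<k} Fcov_m(L^{k−m}z) − ½Σ_{i<j}[Fcov_i, Fcov_j]‖ ≤ 28·(Σ_m ‖Fcov_m‖)³` and `‖log v_k(z) − Σ_{m<k} Fcov_m(L^{k−m}z)‖ ≤ 2·(Σ_m ‖Fcov_m‖)²` whenever `Σ_m‖Fcov_m‖ ≤ 1∕20`

Cell `pub-balaban`, rung (B)+1 sub-cell t4, lineage `b2b-balaban-t4-ne7-p1` (CRUX PROVER NE7 #1 = OWNER of row NE7), generation 96; memo `t4/b2b-balaban-t4-ne7-p1-g96/ROAD-G96.md`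
§7(a)(3)∕§9∕§11 (Γ3).  Over [Balaban1985Averaging] (97) `B7Eq92Concrete.vcov` (`vcov_succ`: `v_{j+1}(z) = v_j(Lz)·wframe_j(Lz)`, `wframe = expUnit ∘ Fcov`) and
[Balaban1988Convergent] (3.72) `B14.Eq372ContourBCH.norm_mlog_holonomy_sub_le` ∕ `norm_pairComm_le`.

WHY (memo §7(a)(3)).  The log-dangerous part of a multi-scale competitor's second-order top response is the COMMUTATOR AREA `½Σ_{i<j}[c_i, c_j]` of the per-level corner frames —
exactly the second-order term of the logarithm of the accumulated frame `v_{k+1} = Π_m w_m`, which THIS FILE isolates in kernel: `log v_k = Σ_m Fcov_m + ½Σ_{i<j}[Fcov_i, Fcov_j] +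
O((Σ‖Fcov_m‖)³)`.  With the first brick (`NE7BlockFrameSecondOrder`: `Fcov_m = frameLin_m + O(Σ lnorm²)`) this is the structure (Γ3) needs: `log v_{k+1} − (accumulated linear frame)`
= the commutator area of the per-level linear frames + one-block second-order terms + cubic.  The sup-capped∕local-energy bookkeeping of (Γ3) is NOT here.
WHAT ([folklore]; 0 def, 0 sorry).  §1 `exists_list_vcov`: for every `k, z` a list `l` (the one-block frame exponents `Fcov_m(L^{k−m}z)`, `m = 0 … k−1`, in level order) with
`holonomy l = v_k(z)`, `contourVar l = Σ_{m<k} Fcov_m(L^{k−m}z)`, `normSum l = Σ_{m<k} ‖Fcov_m(L^{k−m}z)‖` (induction on `k` via `vcov_succ`, appending at the end; no `def`).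
§2 **`norm_mlog_vcov_sub_sum_sub_pairComm_le`** (with the list's `pairComm`, `≤ 28 S³`) and **`norm_mlog_vcov_sub_sum_le`** (`≤ 2 S²`), `S = Σ_{m<k}‖Fcov_m(L^{k−m}z)‖ ≤ 1∕20`.
HONEST FRAMING (page 1): group∕BCH bookkeeping on OUR frame over two printed-type kernel lemmas; nothing of Bałaban's asserted; (Γ3)'s local-energy bound, (Γ4), `hdecomp♭`, NE7 NOT proved;
spine 0∕9; finite T⁴ rung (B)+1 — NOT infinite volume, NOT mass gap, NOT `BetaPertH`, NOT Clay.  Continuum YM on T⁴ ⇐ BetaPertH ∧ nine spine estimates (0/9 proved); BetaPertH ⇐ (D1) ∧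
(D4) ∧ CAP+tail; G-an2-4 gates asym, D1 and NE2/3/4.
-/

set_option autoImplicit false

open scoped BigOperators Matrix Matrix.Norms.L2Operator
open NormedSpace Finset

namespace Summit.QuantumFields.BalabanUV.T4Continuum.NE7AccumulatedFrameSecondOrder

open Literature.MathematicalPhysics.QuantumFieldTheory.Balaban1983to89
open B7Prop1Explicit B7Prop2Explicit MatrixLog
open B7Eq92Concrete (vcov vcov_zero vcov_succ wframe Fcov dbavgCovIter)
open B14.Eq372ContourBCH (holonomy contourVar pairComm normSum normSum_nonneg normSum_cons norm_pairComm_le norm_mlog_holonomy_sub_le)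

noncomputable section

variable {d : ℕ} {n : Type*} [Fintype n] [DecidableEq n]

/-! ## §1 The accumulated frame is an ordered product of the one-block frames -/

/-- `holonomy (l ++ [X]) = holonomy l · e^X`, `contourVar (l ++ [X]) = contourVar l + X`, `normSum (l ++ [X]) = normSum l + ‖X‖`. [folklore] -/
theorem holonomy_append_singleton (l : List (Matrix n n ℂ)) (X : Matrix n n ℂ) :
    holonomy (l ++ [X]) = holonomy l * exp X ∧ contourVar (l ++ [X]) = contourVar l + X ∧ normSum (l ++ [X]) = normSum l + ‖X‖ := by
  refine ⟨?_, ?_, ?_⟩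
  · simp [holonomy, List.map_append, List.prod_append]
  · simp [contourVar, List.sum_append]
  · simp [normSum, List.map_append, List.sum_append]

/-- `↑(wframe L V₀ V₁ y) = exp (Fcov L V₀ V₁ y)` (the block frame is the exponential of its exponent, by definition). [folklore] -/
theorem val_wframe (L : ℕ) (V₀ V₁ : Site d → Fin d → (Matrix n n ℂ)ˣ) (y : Site d) :
    ((wframe L V₀ V₁ y : (Matrix n n ℂ)ˣ) : Matrix n n ℂ) = exp (Fcov L V₀ V₁ y) := by
  rw [wframe, val_expUnit]

/-- **THE ACCUMULATED FRAME (97) AS AN ORDERED PRODUCT OF ONE-BLOCK FRAMES**: for every `k` and `z` there is a list `l` (namely `[Fcov_0(L^{k}z), …, Fcov_{k−1}(Lz)]`,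
`Fcov_m := Fcov L (Ū₀^m) (U̿₁^m)`) with `holonomy l = v_k(z)`, `contourVar l = Σ_{m<k} Fcov_m(L^{k−m}•z)` and `normSum l = Σ_{m<k} ‖Fcov_m(L^{k−m}•z)‖`. [folklore] -/
theorem exists_list_vcov (L : ℕ) (V₀ U₁ : Site d → Fin d → (Matrix n n ℂ)ˣ) (k : ℕ) :
    ∀ z : Site d, ∃ l : List (Matrix n n ℂ),
      holonomy l = ((vcov L V₀ U₁ k z : (Matrix n n ℂ)ˣ) : Matrix n n ℂ) ∧
      contourVar l = ∑ m ∈ range k, Fcov L (avgIter L V₀ m) (dbavgCovIter L V₀ U₁ m) (((L : ℤ) ^ (k - m)) • z) ∧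
      normSum l = ∑ m ∈ range k, ‖Fcov L (avgIter L V₀ m) (dbavgCovIter L V₀ U₁ m) (((L : ℤ) ^ (k - m)) • z)‖ := by
  induction k with
  | zero =>
      intro z
      refine ⟨[], ?_, by simp [contourVar], by simp [normSum]⟩
      rw [vcov_zero, Units.val_one]
      simp [holonomy]
  | succ k ih =>
      intro z
      obtain ⟨l, hl, hc, hn⟩ := ih ((L : ℤ) • z)
      obtain ⟨h1, h2, h3⟩ := holonomy_append_singleton l (Fcov L (avgIter L V₀ k) (dbavgCovIter L V₀ U₁ k) ((L : ℤ) • z))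
      -- the nested corners: `L^{k−m}•(L•z) = L^{k+1−m}•z` for `m ≤ k`
      have hshift : ∀ m ∈ range k, ((L : ℤ) ^ (k - m)) • ((L : ℤ) • z) = ((L : ℤ) ^ (k + 1 - m)) • z := by
        intro m hm
        have hmk : m < k := Finset.mem_range.mp hm
        rw [smul_smul, ← pow_succ, show k - m + 1 = k + 1 - m by omega]
      -- the new factor: `v_{k+1}(z) = v_k(Lz) · e^{Fcov_k(Lz)}`
      have hv : ((vcov L V₀ U₁ (k + 1) z : (Matrix n n ℂ)ˣ) : Matrix n n ℂ)
          = ((vcov L V₀ U₁ k ((L : ℤ) • z) : (Matrix n n ℂ)ˣ) : Matrix n n ℂ)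
            * exp (Fcov L (avgIter L V₀ k) (dbavgCovIter L V₀ U₁ k) ((L : ℤ) • z)) := by
        rw [vcov_succ, Units.val_mul, val_wframe]
      refine ⟨l ++ [Fcov L (avgIter L V₀ k) (dbavgCovIter L V₀ U₁ k) ((L : ℤ) • z)], ?_, ?_, ?_⟩
      · have hmul := congrArg (fun M : Matrix n n ℂ => M * exp (Fcov L (avgIter L V₀ k) (dbavgCovIter L V₀ U₁ k) ((L : ℤ) • z))) hl
        exact h1.trans (hmul.trans hv.symm)
      · have e1 : (((L : ℤ) ^ (k + 1 - k)) • z : Site d) = (L : ℤ) • z := by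
          rw [Nat.add_sub_cancel_left, pow_one]
        have hs : ∑ m ∈ range (k + 1), Fcov L (avgIter L V₀ m) (dbavgCovIter L V₀ U₁ m) (((L : ℤ) ^ (k + 1 - m)) • z)
            = ∑ m ∈ range k, Fcov L (avgIter L V₀ m) (dbavgCovIter L V₀ U₁ m) (((L : ℤ) ^ (k - m)) • ((L : ℤ) • z))
              + Fcov L (avgIter L V₀ k) (dbavgCovIter L V₀ U₁ k) ((L : ℤ) • z) := by
          rw [Finset.sum_range_succ, e1]
          exact congrArg (· + Fcov L (avgIter L V₀ k) (dbavgCovIter L V₀ U₁ k) ((L : ℤ) • z))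
            (Finset.sum_congr rfl fun m hm => by rw [hshift m hm])
        rw [hs, h2, hc]
      · have e1 : (((L : ℤ) ^ (k + 1 - k)) • z : Site d) = (L : ℤ) • z := by
          rw [Nat.add_sub_cancel_left, pow_one]
        have hs : ∑ m ∈ range (k + 1), ‖Fcov L (avgIter L V₀ m) (dbavgCovIter L V₀ U₁ m) (((L : ℤ) ^ (k + 1 - m)) • z)‖
            = ∑ m ∈ range k, ‖Fcov L (avgIter L V₀ m) (dbavgCovIter L V₀ U₁ m) (((L : ℤ) ^ (k - m)) • ((L : ℤ) • z))‖
              + ‖Fcov L (avgIter L V₀ k) (dbavgCovIter L V₀ U₁ k) ((L : ℤ) • z)‖ := by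
          rw [Finset.sum_range_succ, e1]
          exact congrArg (· + ‖Fcov L (avgIter L V₀ k) (dbavgCovIter L V₀ U₁ k) ((L : ℤ) • z)‖)
            (Finset.sum_congr rfl fun m hm => by rw [hshift m hm])
        rw [hs, h3, hn]

/-! ## §2 The accumulated frame to second order -/

/-- **THE ACCUMULATED FRAME TO SECOND ORDER, WITH THE COMMUTATOR AREA**: with `S := Σ_{m<k}‖Fcov_m(L^{k−m}z)‖ ≤ 1∕20` there is an (explicit, level-ordered) list `l` of the
one-block frame exponents with `‖log v_k(z) − Σ_{m<k} Fcov_m(L^{k−m}z) − ½·pairComm l‖ ≤ 28·S³`, `‖pairComm l‖ ≤ S²` ([Balaban1988Convergent] (3.72)'s kernel on the product of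
§1). [folklore] -/
theorem norm_mlog_vcov_sub_sum_sub_pairComm_le (L : ℕ) (V₀ U₁ : Site d → Fin d → (Matrix n n ℂ)ˣ) (k : ℕ) (z : Site d)
    (hS : ∑ m ∈ range k, ‖Fcov L (avgIter L V₀ m) (dbavgCovIter L V₀ U₁ m) (((L : ℤ) ^ (k - m)) • z)‖ ≤ 1 / 20) :
    ∃ l : List (Matrix n n ℂ),
      contourVar l = ∑ m ∈ range k, Fcov L (avgIter L V₀ m) (dbavgCovIter L V₀ U₁ m) (((L : ℤ) ^ (k - m)) • z) ∧
      ‖pairComm l‖ ≤ (∑ m ∈ range k, ‖Fcov L (avgIter L V₀ m) (dbavgCovIter L V₀ U₁ m) (((L : ℤ) ^ (k - m)) • z)‖) ^ 2 ∧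
      ‖mlog ((vcov L V₀ U₁ k z : (Matrix n n ℂ)ˣ) : Matrix n n ℂ)
          - ∑ m ∈ range k, Fcov L (avgIter L V₀ m) (dbavgCovIter L V₀ U₁ m) (((L : ℤ) ^ (k - m)) • z) - (2⁻¹ : ℂ) • pairComm l‖
        ≤ 28 * (∑ m ∈ range k, ‖Fcov L (avgIter L V₀ m) (dbavgCovIter L V₀ U₁ m) (((L : ℤ) ^ (k - m)) • z)‖) ^ 3 := by
  letI : CStarAlgebra (Matrix n n ℂ) := {}
  obtain ⟨l, hl, hc, hn⟩ := exists_list_vcov L V₀ U₁ k z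
  refine ⟨l, hc, ?_, ?_⟩
  · rw [← hn]; exact norm_pairComm_le l
  · rw [← hn] at hS ⊢
    rw [← hl, ← hc]
    exact norm_mlog_holonomy_sub_le l hS

/-- **THE ACCUMULATED FRAME TO SECOND ORDER**: `‖log v_k(z) − Σ_{m<k} Fcov_m(L^{k−m}z)‖ ≤ 2·S²` for `S = Σ_{m<k}‖Fcov_m(L^{k−m}z)‖ ≤ 1∕20` (`½S² + 28S³ ≤ 2S²`). [folklore] -/
theorem norm_mlog_vcov_sub_sum_le (L : ℕ) (V₀ U₁ : Site d → Fin d → (Matrix n n ℂ)ˣ) (k : ℕ) (z : Site d)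
    (hS : ∑ m ∈ range k, ‖Fcov L (avgIter L V₀ m) (dbavgCovIter L V₀ U₁ m) (((L : ℤ) ^ (k - m)) • z)‖ ≤ 1 / 20) :
    ‖mlog ((vcov L V₀ U₁ k z : (Matrix n n ℂ)ˣ) : Matrix n n ℂ)
        - ∑ m ∈ range k, Fcov L (avgIter L V₀ m) (dbavgCovIter L V₀ U₁ m) (((L : ℤ) ^ (k - m)) • z)‖
      ≤ 2 * (∑ m ∈ range k, ‖Fcov L (avgIter L V₀ m) (dbavgCovIter L V₀ U₁ m) (((L : ℤ) ^ (k - m)) • z)‖) ^ 2 := by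
  letI : CStarAlgebra (Matrix n n ℂ) := {}
  obtain ⟨l, -, hp, h3⟩ := norm_mlog_vcov_sub_sum_sub_pairComm_le L V₀ U₁ k z hS
  set S : ℝ := ∑ m ∈ range k, ‖Fcov L (avgIter L V₀ m) (dbavgCovIter L V₀ U₁ m) (((L : ℤ) ^ (k - m)) • z)‖ with hSdef
  have hS0 : 0 ≤ S := Finset.sum_nonneg fun m _ => norm_nonneg _
  have hhalf : ‖(2⁻¹ : ℂ) • pairComm l‖ ≤ 1 / 2 * S ^ 2 := by
    rw [norm_smul]
    have : ‖(2⁻¹ : ℂ)‖ = 1 / 2 := by simp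
    rw [this]
    exact mul_le_mul_of_nonneg_left hp (by norm_num)
  set M : Matrix n n ℂ := mlog ((vcov L V₀ U₁ k z : (Matrix n n ℂ)ˣ) : Matrix n n ℂ)
      - ∑ m ∈ range k, Fcov L (avgIter L V₀ m) (dbavgCovIter L V₀ U₁ m) (((L : ℤ) ^ (k - m)) • z) with hM
  calc ‖M‖ = ‖(M - (2⁻¹ : ℂ) • pairComm l) + (2⁻¹ : ℂ) • pairComm l‖ := by rw [sub_add_cancel]
    _ ≤ 28 * S ^ 3 + 1 / 2 * S ^ 2 := (norm_add_le _ _).trans (add_le_add h3 hhalf)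
    _ ≤ 2 * S ^ 2 := by nlinarith [pow_nonneg hS0 2]

end

end Summit.QuantumFields.BalabanUV.T4Continuum.NE7AccumulatedFrameSecondOrder
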